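import Literature.IUT.HodgeArakelov.MonoThetaCyclotomes
import Literature.IUT.HodgeArakelov.MonoThetaFromGroups
import Literature.IUT.HodgeArakelov.MonoThetaProjective
import Literature.IUT.HodgeArakelov.RadialEnvironments
import Literature.IUT.HodgeArakelov.RadialExamples
import Literature.IUT.HodgeArakelov.RadialGraphs
import Literature.IUT.HodgeArakelov.AbsTopInterfaces
import Mathlib.GroupTheory.Torsion

/-!
# [IUTchII] §1, Corollary 1.12 and Remarks 1.12.1–1.12.5: multiradial constant multiple rigidity

Mochizuki, *Inter-universal Teichmüller theory II*, §1, "the main result of the present §1", kurims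
manuscript (Dec. 2020) pp. 55–63 [claim: Mochizuki2012, status: disputed] (IUTchII §1 Cor 1.12 - Rmk 1.12.5, kurims pp.55-63).
Record-only typing under the claim key `Mochizuki2012` (D-0012, disputed). (Cor. 1.12 and Rmk. 1.12.2 are
cited ×6 / ×4 by [IUTchIII] §2.)

Setting: `Π := Π_X(M^Θ_*)` for a projective system of mono-theta environments with its `θ_env`-data `T`
(Prop. 1.5; this realises the printed identification "`(l·Δ_Θ)(M^Θ_*(Π))` with `(l·Δ_Θ)(Π)` — cf. Prop.
1.4"), a pointed inversion automorphism `(ι, D)` (Rmk. 1.4.1 / Cor. 1.12 (i)). All cohomology modules are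
the INTERFACE `CohomologySystem` (additively written, as the text notes: "the module structure [i.e., which
is usually denoted additively!] of the ambient cohomology module").
* `IUTchII:Cor1.12(i)` — the group-theoretic algorithm `Π ↦ {(ι, D)}(Π)` of pointed inversion automorphisms
  and the notation `(-)^ι` of "ι-invariants up to torsion" — OUTPUT type = `PointedInversion` (Rmk. 1.4.1,
  `MonoThetaProjective`; no separate existence fact), `iotaInvariants` DEFINED for the action on
  `(-)/torsion` INDUCED (`iotaQuotOf`, `ThetaEvaluation.iotaQuot`) by an AUTOMORPHISM of the ambient module,
  with the PROVED agreement `mem_iotaInvariants_iff` with the `IsOfFinAddOrder (ι x - x)` convention of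
  `IotaInvariantThetaR` (v2, review of p409736 item 2: `ι` acts by an automorphism `iotaLim`, not a bare
  endomorphism of the quotient);
* the diagram `(†×θ)(Π)` with (a)–(g): `ThetaEvaluation` (DATA: `M^×_TM(Π) ⊆ lim_J H¹(J,(l·Δ_Θ)(Π)) ⊆ lim_J
  H¹(Π_Ÿ(Π)|_J, …)`, restriction to `D`, the automorphism `iotaLim` by which `ι` acts), `MxTheta` =
  `M^×_TM·∞θ(Π)` DEFINED, `MxThetaEnv` DEFINED by transport along the Cor. 1.10 isomorphism ((b), (d), (f));
* `IUTchII:Cor1.12(ii)` — restriction to `D` maps `{M^×_TM·∞θ(Π)}^ι → M^×_TM(Π)`, "the inverse images of the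
  submodules of torsion elements … are given by `∞θ(Π)^ι`", and the SPLITTINGS
  `(†μθ)(Π) : M^{×μ}_TM(Π) × {∞θ(Π)^ι/M^μ_TM(Π)}` — typed as the `Prop`-structure `Cor112_ii` over the data;
* `IUTchII:Cor1.12(iii)` — the assignment `(… ) ↦ (M^Θ_*(Π), (†×θ)(Π), (†μθ)(Π), (†μ,×μ))` "determines a
  functor `ℛ → ℱ` …; the resulting natural functor `Ψ_ℛ : ℛ → ℛ†` is multiradially defined" — the diagram
  `(†μ,×μ)` as DATA tied to the evaluation objects (`MuXmuDiagram Ev A G Q κ`: v2, review of p409736 item 1 —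
  the first `≅` is PINNED to the Remark 1.5.2 injection `κ` of `Rmk152_kummerTorsion`, `e₁₂_compat`, hence
  unique, `MuXmuDiagram.e₁₂_unique`; the trivial third arrow PROVED, `ThetaEvaluation.mmuTM_to_mxmuTM_eq_zero`);
  the multiradiality is, in the pair-environment model, an instance of the shape theorem
  `cor111_multiradiallyDefined` (`GaloisPairRigidity`; cross-reference, no second name); the printed reason
  ("the characteristic nature of the various torsion submodules `M^μ_TM(-)`") PROVED as
  `torsion_characteristic` (= `IUTchII:Rmk1.12.2(i)` "the submodule … constituted by the `2l`-torsion is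
  characteristic");
* `IUTchII:Rmk1.12.1` — "Corollaries 1.10, 1.11, and 1.12 admit log-shell versions [cf. Example 1.8, (ix)]" —
  an instance of the same shape theorem (Ex. 1.8 (ix) has the shape `ex18iii`, `RadialExamples`); noted;
* Deliberately NOT typed beyond this docstring (C1, expository): `IUTchII:Rmk1.12.2(ii)`,
  `IUTchII:Rmk1.12.2(iii)`, `IUTchII:Rmk1.12.2(iv)`, `IUTchII:Rmk1.12.2(v)`, `IUTchII:Rmk1.12.2(vi)` (recap of
  the [EtTh] Thm. 1.10 algorithm; the hypothetical normalisation by `2 = 1 + 1` of (iii) would be only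
  uniradial; log-shells and `μ`-indeterminacies; "existence vs content"; multiradiality as surjectivity
  split into purely radial / purely coric components), `IUTchII:Rmk1.12.3` (relation to the split
  Frobenioid `ℱ^Θ_v` of [IUTchI] Ex. 3.2 (v)), `IUTchII:Rmk1.12.4` (principle of Galois evaluation, Fig.
  1.5, Section Conjecture), `IUTchII:Rmk1.12.5(i)`, `IUTchII:Rmk1.12.5(ii)`, `IUTchII:Rmk1.12.5(iii)`
  (Gaussian-integral analogy, Figs. 1.6–1.7).
-/

namespace Literature.IUT.HodgeArakelov

open CategoryTheory

universe u

variable {S : ThetaSetting.{u}}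

/-! ## Rmk 1.12.2 (i) / proof of Cor 1.12 (iii): torsion submodules are characteristic (PROVED) -/

/-- **IUTchII:Rmk1.12.2(i)** (kurims p. 58) / proof of Cor. 1.12 (iii): "the [elementary] observation that
the submodule of [any isomorph of] `O^×_k` constituted by the `2l`-torsion is characteristic", "the
characteristic nature of the various torsion submodules `M^μ_TM(-)`" — PROVED: every isomorphism of abelian
groups carries the `n`-torsion onto the `n`-torsion. [claim: Mochizuki2012, status: disputed] (IUTchII §1 Rmk 1.12.2 (i), kurims p.58) -/
theorem torsion_characteristic {A B : Type u} [CommGroup A] [CommGroup B] (e : A ≃* B) (n : ℕ) :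
    ((powMonoidHom n : A →* A).ker).map e.toMonoidHom = (powMonoidHom n : B →* B).ker := by
  ext b
  simp only [Subgroup.mem_map, MonoidHom.mem_ker, powMonoidHom_apply, MulEquiv.coe_toMonoidHom]
  constructor
  · rintro ⟨a, ha, rfl⟩
    rw [← map_pow, ha, map_one]
  · intro hb
    exact ⟨e.symm b, by rw [← map_pow, hb, map_one], by simp⟩

/-- The full torsion subgroup is characteristic as well (PROVED; "the submodules of torsion elements —
i.e., … `M^μ_TM(-)`", Cor. 1.12 (ii)). [claim: Mochizuki2012, status: disputed] (IUTchII §1 Cor 1.12 (ii), kurims p.57) -/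
theorem torsion_characteristic' {A B : Type u} [CommGroup A] [CommGroup B] (e : A ≃* B) :
    (CommGroup.torsion A).map e.toMonoidHom = CommGroup.torsion B := by
  ext b
  simp only [Subgroup.mem_map, CommGroup.mem_torsion, MulEquiv.coe_toMonoidHom]
  constructor
  · rintro ⟨a, ha, rfl⟩
    exact e.toMonoidHom.isOfFinOrder ha
  · intro hb
    exact ⟨e.symm b, e.symm.toMonoidHom.isOfFinOrder hb, by simp⟩

/-! ## Corollary 1.12 (i): pointed inversion automorphisms, `ι`-invariants up to torsion -/

/-! **IUTchII:Cor1.12(i)** (kurims pp. 56–57): "There is a functorial group-theoretic algorithm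
`Π ↦ {(ι, D)}(Π)` that assigns to the topological group `Π` a collection of pairs `(ι, D)` — where
`Δ_Ÿ(Π) := Π_Ÿ(Π) ∩ Δ`, `ι` is a `Δ_Ÿ(Π)`-outer automorphism of `Π_Ÿ(Π)` [cf. Proposition 1.4], and [by abuse
of notation] `D ⊆ Π_Ÿ(Π)` is a `Δ_Ÿ(Π)`-conjugacy class of closed subgroups — with the property that when
`Π = Π^tp_{X̲̲_k}`, the resulting collection of pairs coincides with the collection of pointed inversion
automorphisms of Remark 1.4.1, (ii)." The OUTPUT type of this algorithm is `PointedInversion E D`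
(`MonoThetaProjective`, typed group-theoretically under `IUTchII:Rmk1.4.1`); its existence clause is not a named
fact here (same ruling as for Def. 1.1 / Prop. 1.2: existence = the owners' construction at the model; the
predicate `Rmk141_pointedInversion E D` records "pointed inversion data exist over `(E, D)`"). The NEW content
of (i) typed below is the notation `x^ι` for `ι`-invariants up to torsion. -/

/-- **IUTchII:Cor1.12(i)**, notation (kurims p. 57): "if `ι` induces an action up to torsion on some subset
`(-)` of an abelian group [i.e., an action on the image of this subset in the quotient of the abelian group
by its torsion subgroup], then we shall denote by a superscript `ι` on `(-)` the subset of `ι`-invariants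
with respect to this action up to torsion, i.e., the subset of `(-)` that consists precisely of those
elements of `(-)` whose images in the quotient … by its torsion subgroup are fixed by the induced action of
`ι`." DEFINED for an additive group `L`, an endomorphism `ι` of `L / torsion` (below: the one INDUCED by an
automorphism of `L`, `ThetaEvaluation.iotaQuot`), a subset `X`.
[claim: Mochizuki2012, status: disputed] (IUTchII §1 Cor 1.12 (i), kurims p.57) -/
def iotaInvariants {L : Type u} [AddCommGroup L]
    (ι : L ⧸ AddCommGroup.torsion L →+ L ⧸ AddCommGroup.torsion L) (X : Set L) : Set L :=
  {x ∈ X | ι (QuotientAddGroup.mk x) = QuotientAddGroup.mk x}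

/-- The torsion subgroup is carried onto itself by any automorphism (additive form of
`torsion_characteristic'`; used to induce the action of `ι` on `L / torsion`).
[claim: Mochizuki2012, status: disputed] (IUTchII §1 Cor 1.12 (i), kurims p.57) -/
theorem addTorsion_map_addEquiv {L : Type u} [AddCommGroup L] (e : L ≃+ L) :
    (AddCommGroup.torsion L).map (e : L →+ L) = AddCommGroup.torsion L := by
  ext b
  simp only [AddSubgroup.mem_map, AddCommGroup.mem_torsion, AddMonoidHom.coe_coe]
  constructor
  · rintro ⟨a, ha, rfl⟩
    exact (e : L →+ L).isOfFinAddOrder ha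
  · intro hb
    exact ⟨e.symm b, (e.symm : L →+ L).isOfFinAddOrder hb, by simp⟩

/-- The action on `L / torsion` INDUCED by an automorphism `e` of `L` (DEFINED, `QuotientAddGroup.congr`).
[claim: Mochizuki2012, status: disputed] (IUTchII §1 Cor 1.12 (i), kurims p.57) -/
def iotaQuotOf {L : Type u} [AddCommGroup L] (e : L ≃+ L) :
    L ⧸ AddCommGroup.torsion L ≃+ L ⧸ AddCommGroup.torsion L :=
  QuotientAddGroup.congr _ _ e (addTorsion_map_addEquiv e)

/-- AGREEMENT of the two encodings of "`ι`-invariant up to torsion" in this directory (PROVED): for the action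
induced by an automorphism `e` of `L`, `x ∈ X^ι` iff `x ∈ X` and `e x - x` is torsion — the form used by the
repair file `IotaInvariantThetaR` (`IsOfFinAddOrder (ι x - x)`).
[claim: Mochizuki2012, status: disputed] (IUTchII §1 Cor 1.12 (i), kurims p.57) -/
theorem mem_iotaInvariants_iff {L : Type u} [AddCommGroup L] (e : L ≃+ L) (X : Set L) (x : L) :
    x ∈ iotaInvariants (iotaQuotOf e : _ →+ _) X ↔ x ∈ X ∧ IsOfFinAddOrder (e x - x) := by
  have h : (iotaQuotOf e : L ⧸ AddCommGroup.torsion L →+ L ⧸ AddCommGroup.torsion L)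
      (QuotientAddGroup.mk x) = QuotientAddGroup.mk (e x) := rfl
  simp only [iotaInvariants, Set.mem_setOf_eq, h, QuotientAddGroup.eq_iff_sub_mem, AddCommGroup.mem_torsion]

/-! ## The diagram `(†×θ)(Π)` -/

variable {F : ModelFamily S} {Sys : MonoThetaProjSystem F}

/-- DATA of the diagram **`(†×θ)(Π)`** of Cor. 1.12 (kurims p. 56) over `Π := Π_X(M^Θ_*)`, its
`θ_env`-data `T` and a pointed inversion `(ι, D)`: (c) "one has a natural inclusion
`M^×_TM(Π) ↪ lim_J H¹(J, (l·Δ_Θ)(Π))`, hence a natural inclusion of `M^×_TM(Π)` into the inductive limit of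
the first line" ([AbsTopIII] Def. 3.1 (vi) via Kummer theory — interface: the group
`lim_J H¹(J, (l·Δ_Θ)(Π))` (`Hd`), its injection into `lim_J H¹(Π_Ÿ(Π)|_J, (l·Δ_Θ)(Π))`, the submodule
`M^×_TM(Π)`); the restriction map to the decomposition group `D` (Cor. 1.12 (ii): "restriction to the subgroup
`D ⊆ Π_Ÿ(Π)`"), valued in `Hd`; and the action "up to torsion" of `ι` on the ambient direct limit.
TODO-merge:abc-iut-L4-t2 ([AbsTopIII] Def. 3.1), abc-iut-L2-t1 ([EtTh] Prop. 1.5, Thm. 1.6/1.10).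
[claim: Mochizuki2012, status: disputed] (IUTchII §1 Cor 1.12, kurims p.56) -/
structure ThetaEvaluation (T : ThetaEnvData Sys) (E : EnvOfGroup S Sys.PiX) (I : PointedInversion E T.D) :
    Type (u + 1) where
  /-- `lim_J H¹(J, (l·Δ_Θ)(Π))` -/
  Hd : Type u
  [grpHd : AddCommGroup Hd]
  /-- its inclusion into `lim_J H¹(Π_Ÿ(Π)|_J, (l·Δ_Θ)(Π))` -/
  inclHd : Hd →+ T.D.coh.lim
  inclHd_injective : Function.Injective inclHd
  /-- `M^×_TM(Π)` (c) -/
  MxTM : AddSubgroup Hd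
  /-- restriction to `D` (the "theta evaluation", Rmk. 1.12.4), on the ambient direct limit -/
  resD : T.D.coh.lim →+ Hd
  /-- the action of the AUTOMORPHISM `ι` on `lim_J H¹(Π_Ÿ(Π)|_J, (l·Δ_Θ)(Π))` — an automorphism (review of
  p409736, item 2; same convention as `IotaInvariantTheta'.iotaLim` of `IotaInvariantThetaR`); interface datum:
  induced by `I.iotaYdd`, but NOT derivable here since `CohomologySystem` carries no functoriality in
  automorphisms of `Π` — TODO-merge:abc-iut-L2-t1 -/
  iotaLim : T.D.coh.lim ≃+ T.D.coh.lim

attribute [instance] ThetaEvaluation.grpHd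

namespace ThetaEvaluation

variable {T : ThetaEnvData Sys} {E : EnvOfGroup S Sys.PiX} {I : PointedInversion E T.D}
  (Ev : ThetaEvaluation T E I)

/-- The "action up to torsion" of `ι`: the automorphism of `lim_J H¹(…) / torsion` INDUCED by `iotaLim`
(DEFINED; Cor. 1.12 (i) convention). [claim: Mochizuki2012, status: disputed] (IUTchII §1 Cor 1.12 (i), kurims p.57) -/
def iotaQuot : T.D.coh.lim ⧸ AddCommGroup.torsion T.D.coh.lim ≃+
    T.D.coh.lim ⧸ AddCommGroup.torsion T.D.coh.lim :=
  iotaQuotOf Ev.iotaLim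

/-- The induced action as an endomorphism of `lim / torsion` (the argument of `iotaInvariants`).
[claim: Mochizuki2012, status: disputed] (IUTchII §1 Cor 1.12 (i), kurims p.57) -/
abbrev iotaAct : T.D.coh.lim ⧸ AddCommGroup.torsion T.D.coh.lim →+
    T.D.coh.lim ⧸ AddCommGroup.torsion T.D.coh.lim :=
  (Ev.iotaQuot : _ →+ _)

/-- (e) **`M^×_TM·∞θ(Π) := M^×_TM(Π)·∞θ(Π)`** "where the `·` is to be understood as being taken with
respect to the module structure [additive] of the ambient cohomology module" (DEFINED; `∞θ(Π)` from
Prop. 1.4). [claim: Mochizuki2012, status: disputed] (IUTchII §1 Cor 1.12, kurims p.56) -/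
def MxTheta : Set T.D.coh.lim :=
  Set.image2 (· + ·) (Ev.inclHd '' (Ev.MxTM : Set Ev.Hd)) T.D.thetaInfty

/-- (d) **`M^×_TM(M^Θ_*(Π))`**: "the submodule … induced by the cyclotomic rigidity isomorphism of (b)"
(DEFINED by transport along `T.transportLim`). [claim: Mochizuki2012, status: disputed] (IUTchII §1 Cor 1.12, kurims p.56) -/
def MxTMEnv : AddSubgroup T.cohEnv.lim := (Ev.MxTM.map Ev.inclHd).map T.transportLim.toAddMonoidHom

/-- (f) **`M^×_TM·∞θ_env(M^Θ_*(Π)) := M^×_TM(M^Θ_*(Π))·∞θ_env(M^Θ_*(Π))`** (DEFINED).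
[claim: Mochizuki2012, status: disputed] (IUTchII §1 Cor 1.12, kurims p.56) -/
def MxThetaEnv : Set T.cohEnv.lim :=
  Set.image2 (· + ·) (Ev.MxTMEnv : Set T.cohEnv.lim) T.thetaEnvInfty

/-- PROVED (commutativity of `(†×θ)(Π)`, (b)/(d)/(f)/(g)): the lower row is the image of the upper row
under the vertical isomorphism. [claim: Mochizuki2012, status: disputed] (IUTchII §1 Cor 1.12, kurims p.56) -/
theorem MxThetaEnv_eq_image : Ev.MxThetaEnv = T.transportLim '' Ev.MxTheta := by
  ext y
  simp only [MxThetaEnv, MxTheta, MxTMEnv, ThetaEnvData.thetaEnvInfty_eq_image, Set.mem_image2,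
    Set.mem_image, SetLike.mem_coe, AddSubgroup.mem_map, AddEquiv.coe_toAddMonoidHom]
  constructor
  · rintro ⟨a, ⟨b, ⟨m, hm, rfl⟩, rfl⟩, c, ⟨t, ht, rfl⟩, rfl⟩
    exact ⟨Ev.inclHd m + t, ⟨Ev.inclHd m, ⟨m, hm, rfl⟩, t, ht, rfl⟩, by simp⟩
  · rintro ⟨x, ⟨a, ⟨m, hm, rfl⟩, t, ht, rfl⟩, rfl⟩
    exact ⟨T.transportLim (Ev.inclHd m), ⟨Ev.inclHd m, ⟨m, hm, rfl⟩, rfl⟩, T.transportLim t,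
      ⟨t, ht, rfl⟩, by simp⟩

/-- `M^μ_TM(Π) ⊆ M^×_TM(Π)`, "the submodule of torsion elements" (DEFINED), so that
`M^{×μ}_TM(Π) := M^×_TM(Π)/M^μ_TM(Π)`. [claim: Mochizuki2012, status: disputed] (IUTchII §1 Cor 1.12, kurims p.56) -/
abbrev MmuTM : AddSubgroup Ev.MxTM := AddCommGroup.torsion Ev.MxTM

/-- **`M^{×μ}_TM(Π) := M^×_TM(Π)/M^μ_TM(Π)`** (DEFINED). [claim: Mochizuki2012, status: disputed] (IUTchII §1 Cor 1.12, kurims p.56) -/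
abbrev MxmuTM : Type u := Ev.MxTM ⧸ Ev.MmuTM

end ThetaEvaluation

/-! ## Corollary 1.12 (ii): theta evaluation and the splittings `(†μθ)(Π)` -/

/-- **IUTchII:Cor1.12(ii)** (kurims p. 57), as a `Prop`-valued structure over the data: "restriction to the
subgroup `D ⊆ Π_Ÿ(Π)` determines [the horizontal arrows in] a commutative diagram
`{M^×_TM·∞θ(Π)}^ι → M^×_TM(Π) (⊆ lim_J H¹(J,(l·Δ_Θ)(Π)))` [over] `{M^×_TM·∞θ_env(M^Θ_*(Π))}^ι → M^×_TM(M^Θ_*(Π))`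
… the vertical arrows are the isomorphisms induced by the cyclotomic rigidity isomorphism of Corollary 1.10
… Here, the inverse images of the submodules of torsion elements … via the upper and lower horizontal arrows
are given, respectively, by `∞θ(Π)^ι` and `∞θ_env(M^Θ_*(Π))^ι`. In particular, we obtain a functorial
algorithm … for constructing splittings `M^{×μ}_TM(Π) × {∞θ(Π)^ι/M^μ_TM(Π)}` … — i.e., direct product
decompositions inside the quotients of the inductive limits … by `M^μ_TM(-)` — of the respective images of
`{M^×_TM·∞θ(Π)}^ι` …". (The lower row is the transport of the upper one — `MxThetaEnv_eq_image` — so the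
statement is recorded for the upper row.) [claim: Mochizuki2012, status: disputed] (IUTchII §1 Cor 1.12 (ii), kurims p.57) -/
structure Cor112_ii {T : ThetaEnvData Sys} {E : EnvOfGroup S Sys.PiX} {I : PointedInversion E T.D}
    (Ev : ThetaEvaluation T E I) : Prop where
  /-- restriction to `D` maps `{M^×_TM·∞θ(Π)}^ι` into `M^×_TM(Π)` -/
  res_mem : ∀ x ∈ iotaInvariants Ev.iotaAct Ev.MxTheta, Ev.resD x ∈ Ev.MxTM
  /-- "the inverse images of the submodules of torsion elements … are given by `∞θ(Π)^ι`" -/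
  torsion_preimage : ∀ x ∈ iotaInvariants Ev.iotaAct Ev.MxTheta,
    IsOfFinAddOrder (Ev.resD x) ↔ x ∈ iotaInvariants Ev.iotaAct T.D.thetaInfty
  /-- the splitting `(†μθ)(Π)`: modulo torsion, every element of `{M^×_TM·∞θ(Π)}^ι` is uniquely the sum of
  (the image of) an element of `M^×_TM(Π)` and an element of `∞θ(Π)^ι` -/
  splitting : ∀ x ∈ iotaInvariants Ev.iotaAct Ev.MxTheta,
    ∃ m ∈ (Ev.MxTM : Set Ev.Hd), ∃ t ∈ iotaInvariants Ev.iotaAct T.D.thetaInfty,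
      (QuotientAddGroup.mk x : T.D.coh.lim ⧸ AddCommGroup.torsion T.D.coh.lim) =
        QuotientAddGroup.mk (Ev.inclHd m + t) ∧
      ∀ m' ∈ (Ev.MxTM : Set Ev.Hd), ∀ t' ∈ iotaInvariants Ev.iotaAct T.D.thetaInfty,
        (QuotientAddGroup.mk x : T.D.coh.lim ⧸ AddCommGroup.torsion T.D.coh.lim) =
          QuotientAddGroup.mk (Ev.inclHd m' + t') →
        (QuotientAddGroup.mk (Ev.inclHd m') : T.D.coh.lim ⧸ AddCommGroup.torsion T.D.coh.lim) =
          QuotientAddGroup.mk (Ev.inclHd m) ∧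
        (QuotientAddGroup.mk t' : T.D.coh.lim ⧸ AddCommGroup.torsion T.D.coh.lim) =
          QuotientAddGroup.mk t

/-! The existence / canonicity of the theta-evaluation data for the genuine `Π` ("follows immediately from the
structure of the objects under consideration, as described in [EtTh], Proposition 1.5, (ii), (iii)") is the
owners' construction (abc-iut-L2-t1, abc-iut-L4-t2) and is not typed as a named fact (an existential over the
interface `ThetaEvaluation` would be content-free); `Cor112_ii Ev` is the printed property AS A PREDICATE on
given evaluation data. -/

/-! ## Corollary 1.12 (iii): the diagram `(†μ,×μ)` and multiradiality -/

/-- `M^μ_TM(M^Θ_*(Π))`: the torsion of the mono-theta-side copy `M^×_TM(M^Θ_*(Π))` (DEFINED).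
[claim: Mochizuki2012, status: disputed] (IUTchII §1 Cor 1.12 (iii), kurims p.58) -/
abbrev ThetaEvaluation.MmuTMEnv {T : ThetaEnvData Sys} {E : EnvOfGroup S Sys.PiX} {I : PointedInversion E T.D}
    (Ev : ThetaEvaluation T E I) : AddSubgroup Ev.MxTMEnv :=
  AddCommGroup.torsion Ev.MxTMEnv

/-- The third arrow of `(†μ,×μ)`, `M^μ_TM(Π) → M^{×μ}_TM(Π) = M^×_TM(Π)/M^μ_TM(Π)`, "is the trivial
homomorphism" (kurims p. 58) — PROVED: the torsion maps to `0` in the quotient by the torsion (this is the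
triviality singled out in `IUTchII:Rmk1.11.3(iii)` (b), cf. `GaloisPairRigidityReadings`).
[claim: Mochizuki2012, status: disputed] (IUTchII §1 Cor 1.12 (iii), kurims p.58) -/
theorem ThetaEvaluation.mmuTM_to_mxmuTM_eq_zero {T : ThetaEnvData Sys} {E : EnvOfGroup S Sys.PiX}
    {I : PointedInversion E T.D} (Ev : ThetaEvaluation T E I) (m : Ev.MxTM) (hm : m ∈ Ev.MmuTM) :
    (QuotientAddGroup.mk m : Ev.MxmuTM) = 0 := by
  rwa [QuotientAddGroup.eq_zero_iff]

/-- DATA of the diagram **`(†μ,×μ)`** of Cor. 1.12 (iii) (kurims p. 58):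
`Π_μ(M^Θ_*(Π)) ⊗ ℚ/ℤ ≅ M^μ_TM(M^Θ_*(Π)) ≅ M^μ_TM(Π) → M^{×μ}_TM(Π) ≅ O^{×μ}(G)` — "the first `≅` is the
isomorphism determined by the injection of Remark 1.5.2; the second `≅` is the isomorphism determined by the
vertical arrows of `(†×θ)(Π)`; the `→` is the trivial homomorphism; the final `≅` denotes the
poly-isomorphism induced by the poly-isomorphism `α_×` of Example 1.8, (iii)". TIED to the typed objects: over
theta-evaluation data `Ev`, the [AbsTopIII] interface `A` and `G ≅ G_k`, with `Π_μ(M^Θ_*(Π)) ⊗ ℚ/ℤ` an abstract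
group `Q` TOGETHER WITH the injection `κ : Π_μ(M^Θ_*(Π)) ⊗ ℚ/ℤ ↪ lim_J H¹(Π_Ÿ(M^Θ_*)|_J, Π_μ(M^Θ_*))` of
Remark 1.5.2 (the datum of `Rmk152_kummerTorsion T Q κ`, which is the intended hypothesis on `κ`):
`M^μ_TM(M^Θ_*(Π)) = Ev.MmuTMEnv`, `M^μ_TM(Π) = Ev.MmuTM`, `M^{×μ}_TM(Π) = Ev.MxmuTM` (third arrow:
`ThetaEvaluation.mmuTM_to_mxmuTM_eq_zero`), `O^{×μ}(G) = A.Oxmu G`; the first `≅` is PINNED to `κ`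
(`e₁₂_compat`, review of p409736 item 1), the second `≅` is pinned by compatibility with the vertical arrow
`transportLim`. NOT pinned here: the last poly-isomorphism (it rests on the Kummer identification
`M_TM(Π)^× ≅ M^×_TM(Π)`, [AbsTopIII] Prop. 3.2, which the cohomology interface does not carry) — recorded as a
nonempty SET of isomorphisms. [claim: Mochizuki2012, status: disputed] (IUTchII §1 Cor 1.12 (iii), kurims p.58) -/
structure MuXmuDiagram {T : ThetaEnvData Sys} {E : EnvOfGroup S Sys.PiX} {I : PointedInversion E T.D}
    (Ev : ThetaEvaluation T E I) (A : AbsTopMonoids S) (G : IsoClass S.Gk) (Q : Type u) [AddCommGroup Q]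
    (κ : Q →+ T.cohEnv.lim) : Type u where
  /-- the isomorphism `Π_μ(M^Θ_*(Π)) ⊗ ℚ/ℤ ≅ M^μ_TM(M^Θ_*(Π))` "determined by the injection of Remark 1.5.2" -/
  e₁₂ : Q ≃+ Ev.MmuTMEnv
  /-- … DETERMINED BY `κ`: inside `lim_J H¹(Π_Ÿ(M^Θ_*)|_J, Π_μ(M^Θ_*))`, `e₁₂ q` is `κ q` -/
  e₁₂_compat : ∀ q : Q, (((e₁₂ q : Ev.MmuTMEnv) : Ev.MxTMEnv) : T.cohEnv.lim) = κ q
  /-- the isomorphism `M^μ_TM(M^Θ_*(Π)) ≅ M^μ_TM(Π)` "determined by the vertical arrows of `(†×θ)(Π)`" -/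
  e₂₃ : Ev.MmuTMEnv ≃+ Ev.MmuTM
  e₂₃_compat : ∀ x : Ev.MmuTMEnv,
    T.transportLim (Ev.inclHd (((e₂₃ x : Ev.MmuTM) : Ev.MxTM) : Ev.Hd)) = ((x : Ev.MxTMEnv) : T.cohEnv.lim)
  /-- the poly-isomorphism `M^{×μ}_TM(Π) ≅ O^{×μ}(G)` induced by `α_×` (a nonempty set of isomorphisms) -/
  poly₄₅ : Set (Multiplicative Ev.MxmuTM ≃* A.Oxmu G)
  poly₄₅_nonempty : poly₄₅.Nonempty

/-- With `κ` the injection of Remark 1.5.2, the first isomorphism of `(†μ,×μ)` is UNIQUELY determined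
(PROVED: two diagrams over the same `κ` have the same `e₁₂`).
[claim: Mochizuki2012, status: disputed] (IUTchII §1 Cor 1.12 (iii), kurims p.58) -/
theorem MuXmuDiagram.e₁₂_unique {T : ThetaEnvData Sys} {E : EnvOfGroup S Sys.PiX} {I : PointedInversion E T.D}
    {Ev : ThetaEvaluation T E I} {A : AbsTopMonoids S} {G : IsoClass S.Gk} {Q : Type u} [AddCommGroup Q]
    {κ : Q →+ T.cohEnv.lim} (Δ₁ Δ₂ : MuXmuDiagram Ev A G Q κ) : Δ₁.e₁₂ = Δ₂.e₁₂ := by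
  ext q
  exact (Δ₁.e₁₂_compat q).trans (Δ₂.e₁₂_compat q).symm

/-! **IUTchII:Cor1.12(iii)**, multiradiality (kurims pp. 57–58): "Consider the assignment that associates to the
data `(Π ↷ Π_μ(M^Θ_*(Π)) ⊗ ℚ/ℤ, G ↷ O^{×μ}(G), α_{μ,×μ})` the data consisting of `M^Θ_*(Π)` …; `(†×θ)(Π)` — i.e.,
"subsets"; `(†μθ)(Π)` — i.e., "splittings"; the diagram `(†μ,×μ)` … Then this assignment determines a functor
`ℛ → ℱ` which arises from a functorial algorithm; … the resulting natural functor `Ψ_ℛ : ℛ → ℛ†` … is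
multiradially defined" (printed proof: "follows immediately from the characteristic nature of the various
torsion submodules", cf. `torsion_characteristic'`). In the pair-environment model, with `(ℛ, 𝒞, Φ)` the Ex. 1.8
(v)/(vi) environment of shape `ex18iii S Ism`, this is an INSTANCE of the shape theorem
`cor111_multiradiallyDefined S Ism Ξ` (`GaloisPairRigidity`; every functor out of `ℛ` is multiradially
defined) — cross-reference, no second name (the specific functor `ℛ → ℱ` is not built here; the typed content
of (iii) is the diagram `MuXmuDiagram`). **IUTchII:Rmk1.12.1** (p. 58: "Corollaries 1.10, 1.11, and 1.12 admit
log-shell versions [cf. Example 1.8, (ix)]") — likewise an instance of the same shape theorem (Ex. 1.8 (ix) has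
the shape `ex18iii`, `RadialExamples`); noted. -/

end Literature.IUT.HodgeArakelov
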